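import Summits.ResolutionOfSingularities.ResolutionOfSingularities.Theorems.EquisingularLiftEquisingularLiftReducedStrictTransformBlowup
import Literature.AlgebraicGeometry.Resolution.RegularBlowup
import Literature.AlgebraicGeometry.Resolution.BlowupsIntegral
import Literature.AlgebraicGeometry.Motives.ZariskiChowCover
import Mathlib.AlgebraicGeometry.Morphisms.UniversallyClosed
import HarnessLib

/-!
# [OURS · L1 W4.5(b)] EL♮ helper H-COMB, part 3 — scheme level: the strict transform of a regular
# closed subscheme meeting the centre in a regular scheme is regular (COMB C1)

Support file of the crux chain w45b (cell `res-hironaka`, LADDER-RESOLUTION rung L, slot W4.5(b)), working crux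
**EL♮ = `EquisingularLiftNat`** (stmt-ResolutionOfSingularities-20038; bookkeeping node stmt-ResolutionOfSingularities-15660),
research stub `stub_elnat_three(_horiz)` of line `sections`; the scheme-level phrasing **COMB C1
`strictTransform_isRegular_of_reducedPointMeet`** of res-L1-w45b-plan-1's DEAL 04:45:57Z / DE-COLLIDE v2 (b)
(«P regular, s ⊂ P regular closed (the section), D ⊂ P regular closed with D ∩ s one REDUCED closed point ⇒
the reduced strict transform of D in Bl_s P is REGULAR — `= Bl_{s ∩ D} D` via
`StrataSplit.exists_isBlowup_reducedStrictTransform` p167331, then `IsBlowup.isRegular_of_isRegular_subscheme`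
with the reduced point as regular centre»), stated at its natural generality: ANY centre `C`, ANY irreducible
closed `S ⊄ V(C)` whose reduced structure `D = V(S)_red` is regular and meets the centre in a REGULAR scheme
`(C·𝒪_D).subscheme` — then the reduced strict transform `V(closure τ⁻¹(S ∖ V(C)))_red ⊂ X'` is regular. This is
the `Scheme.IsRegular C.subscheme` currency of the lead's HorizChainE1 step (res-L1-w45b-lead-2 05:23:05Z) for the
COMB centre `St(ℓ̃)` of CRUX-PLAN v3 §1.7 (H-COMB; parts 1–2 = the chart algebra
`…EquisingularLiftNatAdaptedEquation` / `…EquisingularLiftNatCombCentre`: `ϖ`-distance one ⟺ `ℓ̃ ∩ s = Spec k`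
reduced, hence regular). Filed `--supports stmt-ResolutionOfSingularities-20038` by res-L1-w45b-stub-3. OURS,
kernel-checked assembly of two tree theorems; replaces the role of NOTHING in H. Hironaka's manuscript and is NOT a
statement of it. AI review is weaker than expert review.

* `isRegular_reducedStrictTransform_of_isRegular_comap` — REGULARITY: the general statement (Stacks 080E (1) +
  Liu Thm. 8.1.19 (a));
* `isRegular_of_isField_stalk` — the «reduced point» reading of its hypothesis (a scheme whose local rings are
  fields is regular);
* `comap_vanishingIdeal_ne_bot` — `S ⊄ V(C)` ⇒ the restricted centre `C·𝒪_D ≠ ⊥`;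
* `isIntegral_reducedStrictTransform` — INTEGRALITY of the reduced strict transform (blow-up of the integral
  `V(S)_red` along a non-zero ideal, Stacks 02ND);
* (rev 2) `exists_isIso_reducedStrictTransform_of_isEffectiveCartier`, `isRegular_reducedStrictTransform_of_isEffectiveCartier`
  — tri-1's PRINCIPLE `strictTransform_in_carrier_iso`: `C·𝒪_D` effective Cartier ⇒ `T ≅ D` over `X` (hence regular if
  `D` is);
* (rev 3) `nonempty_iso_subscheme_comap_ker_symm`, `isRegular_subscheme_comap_ker_symm` — `V(𝓘_S·𝒪_D) ≅ V(𝓘_D·𝒪_S)`: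
  the hypothesis `hDC` for a section centre `C = s.ker` may be checked inside `S = Spec O` (reduced point at
  `ϖ`-distance one, tree `isRegular_subscheme_vanishingIdeal_singleton`);
* `flat_reducedStrictTransform_comp` — FLATNESS over a principal base `Spec O` (DVR): if `D → Spec O` is
  surjective then so is `T → D → Spec O` (`T → D` proper birational, hence surjective), and an integral scheme
  surjective over a PID is flat (Hartshorne III 9.7, tree theorem `flat_of_isIntegral_of_surjective`).
Together: the `IsRegular` and `Flat` entries of the lead's HorizChainE1 step for ANY strict-transform centre
(COMB: `St(ℓ̃)`; SUB-LIFT: `St_{C_Δ}(D′)` of CRUX-PLAN v3 §1.7 (b)), leaving only the two support conditions.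
What is NOT here: the special fibre of the strict transform (C2; chart-wise it is parts 1–2:
`(O[X]/(θᵢ g))/(ϖ) ≃+* k[X]/(Xᵢ·h̄)`), and the E1 inclusion `e ⊆ H_i` (H-CONE, landed by res-L1-w45b-stub-1).

References: The Stacks Project, Tag 080E; Q. Liu, *Algebraic Geometry and Arithmetic Curves*, OUP 2002,
Thm. 8.1.19 (a), §8.1.
-/

set_option linter.dupNamespace false -- mandated namespace of this single-conjunct summit

noncomputable section

open CategoryTheory AlgebraicGeometry TopologicalSpace Topology
open Literature.AlgebraicGeometry.Resolution

namespace Summit.ResolutionOfSingularities.ResolutionOfSingularities.Theorems.EquisingularLiftNat.CombCentre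

/-- **COMB C1 (general form).** Let `τ : X' → X` be a proper blow-up of the locally Noetherian scheme `X` along
`C`, `S ⊆ X` an irreducible closed subset not contained in `V(C)`, `D = V(S)_red` its reduced closed subscheme.
If `D` is regular and the scheme-theoretic intersection `D ∩ V(C) = V(C·𝒪_D)` is a regular scheme, then the
reduced strict transform `V(closure τ⁻¹(S ∖ V(C)))_red ⊆ X'` is regular: it is a blow-up of `D` along `C·𝒪_D`
(tree theorem `StrataSplit.exists_isBlowup_reducedStrictTransform`, Stacks 080E (1)) and blow-ups of regular
schemes in regular centres are regular (tree theorem `IsBlowup.isRegular_of_isRegular_subscheme`, Liu 8.1.19 (a)).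
[cite: Liu2002, Thm. 8.1.19 (a)] -/
theorem isRegular_reducedStrictTransform_of_isRegular_comap (X X' : Scheme.{0}) [IsLocallyNoetherian X]
    [IsLocallyNoetherian X'] (τ : X' ⟶ X) (C : X.IdealSheafData) (hτ : IsBlowup τ C) [IsProper τ]
    (S : Set X) (hS : IsClosed S) (hirr : IsIrreducible S) (hSC : ¬ S ⊆ (C.support : Set X))
    (hD : Scheme.IsRegular (Scheme.IdealSheafData.vanishingIdeal (⟨S, hS⟩ : Closeds X)).subscheme)
    (hDC : Scheme.IsRegular (C.comap
      (Scheme.IdealSheafData.vanishingIdeal (⟨S, hS⟩ : Closeds X)).subschemeι).subscheme) :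
    Scheme.IsRegular (Scheme.IdealSheafData.vanishingIdeal
      (⟨closure (τ ⁻¹' (S \ (C.support : Set X))), isClosed_closure⟩ : Closeds X')).subscheme := by
  obtain ⟨ρ, -, -, hρ⟩ :=
    Cruxes.EquisingularLift.StrataSplit.exists_isBlowup_reducedStrictTransform X X' τ C hτ S hS hirr hSC
  haveI : IsLocallyNoetherian (Scheme.IdealSheafData.vanishingIdeal (⟨S, hS⟩ : Closeds X)).subscheme :=
    LocallyOfFiniteType.isLocallyNoetherian
      (Scheme.IdealSheafData.vanishingIdeal (⟨S, hS⟩ : Closeds X)).subschemeι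
  exact hρ.isRegular_of_isRegular_subscheme hD hDC

/-- A scheme all of whose local rings are fields (e.g. a reduced point `Spec κ`, the scheme-theoretic
intersection `ℓ̃ ∩ s` of a relative curve with a section at `ϖ`-distance one) is regular: fields are regular
local rings. The «reduced point» reading of COMB C1's hypothesis. [folklore] -/
theorem isRegular_of_isField_stalk {Y : Scheme.{0}} (h : ∀ y : Y, IsField (Y.presheaf.stalk y)) :
    Scheme.IsRegular Y := fun y => by
  letI := (h y).toField
  infer_instance

/-- The restricted centre `C·𝒪_D` of `D = V(S)_red` is not the zero ideal when `S ⊄ V(C)`. [folklore] -/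
theorem comap_vanishingIdeal_ne_bot {X : Scheme.{0}} (C : X.IdealSheafData) (S : Set X) (hS : IsClosed S)
    (hSC : ¬ S ⊆ (C.support : Set X)) :
    C.comap (Scheme.IdealSheafData.vanishingIdeal (⟨S, hS⟩ : Closeds X)).subschemeι ≠ ⊥ := by
  intro h
  apply hSC
  have key : ∀ z, (Scheme.IdealSheafData.vanishingIdeal (⟨S, hS⟩ : Closeds X)).subschemeι z ∈
      (C.support : Set X) := by
    intro z
    have hz : z ∈ ((C.comap
        (Scheme.IdealSheafData.vanishingIdeal (⟨S, hS⟩ : Closeds X)).subschemeι).support : Set _) := by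
      rw [h]
      simp only [Scheme.IdealSheafData.support_bot, Closeds.coe_top, Set.mem_univ]
    rwa [Scheme.IdealSheafData.support_comap, Closeds.coe_preimage] at hz
  have hrange : Set.range (Scheme.IdealSheafData.vanishingIdeal (⟨S, hS⟩ : Closeds X)).subschemeι = S := by
    rw [Scheme.IdealSheafData.range_subschemeι, Scheme.IdealSheafData.coe_support_vanishingIdeal]
    rfl
  intro x hx
  rw [← hrange] at hx
  obtain ⟨z, rfl⟩ := hx
  exact key z

/-- **COMB C1, integrality.** With `τ`, `C`, `S` as above (`S` irreducible closed, `S ⊄ V(C)`), the reduced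
strict transform `V(closure τ⁻¹(S ∖ V(C)))_red` is an INTEGRAL scheme: a blow-up (Stacks 080E (1)) of the
integral scheme `V(S)_red` along a non-zero ideal (Stacks 02ND, tree theorem `IsBlowup.isIntegral`).
[cite: StacksProject, Tag 02ND] -/
theorem isIntegral_reducedStrictTransform (X X' : Scheme.{0}) [IsLocallyNoetherian X]
    [IsLocallyNoetherian X'] (τ : X' ⟶ X) (C : X.IdealSheafData) (hτ : IsBlowup τ C) [IsProper τ]
    (S : Set X) (hS : IsClosed S) (hirr : IsIrreducible S) (hSC : ¬ S ⊆ (C.support : Set X)) :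
    IsIntegral (Scheme.IdealSheafData.vanishingIdeal
      (⟨closure (τ ⁻¹' (S \ (C.support : Set X))), isClosed_closure⟩ : Closeds X')).subscheme := by
  obtain ⟨ρ, -, -, hρ⟩ :=
    Cruxes.EquisingularLift.StrataSplit.exists_isBlowup_reducedStrictTransform X X' τ C hτ S hS hirr hSC
  haveI : IsIntegral (Scheme.IdealSheafData.vanishingIdeal (⟨S, hS⟩ : Closeds X)).subscheme :=
    ComponentGluing.isIntegral_subscheme_vanishingIdeal ⟨S, hS⟩ hirr
  exact hρ.isIntegral (comap_vanishingIdeal_ne_bot C S hS hSC)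

/-- **COMB C1, flatness over a principal base.** Let moreover `f : X → Spec O` with `O` a principal ideal
domain (e.g. a DVR) and suppose `D = V(S)_red → Spec O` is surjective (e.g. `D` flat and proper over `O` with
non-empty special fibre). Then the reduced strict transform `T` is FLAT over `O` along `T ↪ X' → X → Spec O`:
`T → D` is a proper dominant (birational) map, hence surjective, so `T → Spec O` is surjective, and an integral
scheme surjective over a principal ideal domain is flat (Hartshorne III 9.7, tree theorem
`flat_of_isIntegral_of_surjective`). This is the `Flat` entry of a HorizChainE1 step for a strict-transform
centre. [cite: Hartshorne1977, III Prop. 9.7] -/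
theorem flat_reducedStrictTransform_comp {O : Type} [CommRing O] [IsDomain O] [IsPrincipalIdealRing O]
    (X X' : Scheme.{0}) [IsLocallyNoetherian X] [IsLocallyNoetherian X'] (τ : X' ⟶ X)
    (C : X.IdealSheafData) (hτ : IsBlowup τ C) [IsProper τ] (S : Set X) (hS : IsClosed S)
    (hirr : IsIrreducible S) (hSC : ¬ S ⊆ (C.support : Set X)) (f : X ⟶ Spec (.of O))
    [Surjective ((Scheme.IdealSheafData.vanishingIdeal (⟨S, hS⟩ : Closeds X)).subschemeι ≫ f)] :
    Flat ((Scheme.IdealSheafData.vanishingIdeal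
      (⟨closure (τ ⁻¹' (S \ (C.support : Set X))), isClosed_closure⟩ : Closeds X')).subschemeι ≫ τ ≫ f) := by
  obtain ⟨ρ, hcomm, hproper, hρ⟩ :=
    Cruxes.EquisingularLift.StrataSplit.exists_isBlowup_reducedStrictTransform X X' τ C hτ S hS hirr hSC
  haveI : IsIntegral (Scheme.IdealSheafData.vanishingIdeal (⟨S, hS⟩ : Closeds X)).subscheme :=
    ComponentGluing.isIntegral_subscheme_vanishingIdeal ⟨S, hS⟩ hirr
  haveI : IsLocallyNoetherian (Scheme.IdealSheafData.vanishingIdeal (⟨S, hS⟩ : Closeds X)).subscheme :=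
    LocallyOfFiniteType.isLocallyNoetherian
      (Scheme.IdealSheafData.vanishingIdeal (⟨S, hS⟩ : Closeds X)).subschemeι
  have hJ := comap_vanishingIdeal_ne_bot C S hS hSC
  haveI := hρ.isIntegral hJ
  haveI : IsProper ρ := hproper
  haveI : IsDominant ρ := (hρ.isBirational' hJ).isDominant
  haveI : Surjective ρ := inferInstance
  haveI : Surjective (ρ ≫ (Scheme.IdealSheafData.vanishingIdeal (⟨S, hS⟩ : Closeds X)).subschemeι ≫ f) :=
    inferInstance
  have hfac : (Scheme.IdealSheafData.vanishingIdeal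
      (⟨closure (τ ⁻¹' (S \ (C.support : Set X))), isClosed_closure⟩ : Closeds X')).subschemeι ≫ τ ≫ f =
      ρ ≫ (Scheme.IdealSheafData.vanishingIdeal (⟨S, hS⟩ : Closeds X)).subschemeι ≫ f := by
    rw [← Category.assoc, ← hcomm, Category.assoc]
  rw [hfac]
  exact Literature.AlgebraicGeometry.Motives.ZariskiChow.flat_of_isIntegral_of_surjective _

/-! ## rev 2 (append-only): `strictTransform_in_carrier_iso` — tri-1's PRINCIPLE (TRIAGE v4 §−4.B (4)) -/

/-- **`strictTransform_in_carrier_iso`** (res-L1-w45b-tri-1 TRIAGE v4 §−4.B (4) PRINCIPLE; CHAIN v7 §3 row «H-COMB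
part 2»). If the restricted centre `C·𝒪_D` is an EFFECTIVE CARTIER ideal of `D = V(S)_red` — e.g. `D` lies in a regular
carrier in which the centre `V(C)` is a Cartier divisor not containing `D` (all combs `C_a` live in the regular 3-fold
`St(Ẽ)`, so for `C_b ⊄ C_a` the ideal `I_{C_a}·𝒪_{C_b}` is invertible) — then the reduced strict transform `T` of `S`
under the blow-up `τ` along `C` is ISOMORPHIC to `D` over `X`: `ρ : T ⟶ D`, `ρ ≫ ι_D = ι_T ≫ τ`, `IsIso ρ` (`T → D` is a
blow-up along `C·𝒪_D`, Stacks 080E (1), and blowing up an effective Cartier divisor is an isomorphism, tree theorem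
`IsBlowup.isIso`, Görtz–Wedhorn I 13.91). Whatever `C_a ∩ C_b` is, `St_{C_a}(C_b) ≅ C_b`.
[cite: GortzWedhorn2020, (13.19) p. 413] -/
theorem exists_isIso_reducedStrictTransform_of_isEffectiveCartier (X X' : Scheme.{0}) [IsLocallyNoetherian X]
    [IsLocallyNoetherian X'] (τ : X' ⟶ X) (C : X.IdealSheafData) (hτ : IsBlowup τ C) [IsProper τ]
    (S : Set X) (hS : IsClosed S) (hirr : IsIrreducible S) (hSC : ¬ S ⊆ (C.support : Set X))
    (hcart : IsEffectiveCartier (C.comap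
      (Scheme.IdealSheafData.vanishingIdeal (⟨S, hS⟩ : Closeds X)).subschemeι)) :
    ∃ ρ : (Scheme.IdealSheafData.vanishingIdeal
        (⟨closure (τ ⁻¹' (S \ (C.support : Set X))), isClosed_closure⟩ : Closeds X')).subscheme ⟶
        (Scheme.IdealSheafData.vanishingIdeal (⟨S, hS⟩ : Closeds X)).subscheme,
      ρ ≫ (Scheme.IdealSheafData.vanishingIdeal (⟨S, hS⟩ : Closeds X)).subschemeι =
        (Scheme.IdealSheafData.vanishingIdeal
          (⟨closure (τ ⁻¹' (S \ (C.support : Set X))), isClosed_closure⟩ : Closeds X')).subschemeι ≫ τ ∧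
      IsIso ρ := by
  obtain ⟨ρ, hcomm, -, hρ⟩ :=
    Cruxes.EquisingularLift.StrataSplit.exists_isBlowup_reducedStrictTransform X X' τ C hτ S hS hirr hSC
  exact ⟨ρ, hcomm, hρ.isIso hcart⟩

/-- Corollary of the PRINCIPLE: with `C·𝒪_D` effective Cartier and `D` regular, the reduced strict transform is
regular (it is isomorphic to `D`). [folklore] -/
theorem isRegular_reducedStrictTransform_of_isEffectiveCartier (X X' : Scheme.{0}) [IsLocallyNoetherian X]
    [IsLocallyNoetherian X'] (τ : X' ⟶ X) (C : X.IdealSheafData) (hτ : IsBlowup τ C) [IsProper τ]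
    (S : Set X) (hS : IsClosed S) (hirr : IsIrreducible S) (hSC : ¬ S ⊆ (C.support : Set X))
    (hD : Scheme.IsRegular (Scheme.IdealSheafData.vanishingIdeal (⟨S, hS⟩ : Closeds X)).subscheme)
    (hcart : IsEffectiveCartier (C.comap
      (Scheme.IdealSheafData.vanishingIdeal (⟨S, hS⟩ : Closeds X)).subschemeι)) :
    Scheme.IsRegular (Scheme.IdealSheafData.vanishingIdeal
      (⟨closure (τ ⁻¹' (S \ (C.support : Set X))), isClosed_closure⟩ : Closeds X')).subscheme := by
  obtain ⟨ρ, -, hiso⟩ :=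
    exists_isIso_reducedStrictTransform_of_isEffectiveCartier X X' τ C hτ S hS hirr hSC hcart
  haveI := hiso
  exact Scheme.IsRegular.of_isOpenImmersion ρ hD

/-! ## rev 3 (append-only): the hypothesis `hDC` read on the other factor — symmetry of `D ∩ V(C)` -/

/-- **Symmetry of the scheme-theoretic intersection.** For two closed immersions `i : D ⟶ U` and `s : S ⟶ U` the
closed subscheme `V(𝓘_S·𝒪_D) ⊆ D` (ideal sheaf `s.ker.comap i`) and the closed subscheme `V(𝓘_D·𝒪_S) ⊆ S` (ideal
sheaf `i.ker.comap s`) are isomorphic — both are the fibre product `D ×_U S` (Mathlib `IdealSheafData.comapIso`,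
`pullbackSymmetry`, `Hom.toImage`). [folklore] -/
theorem nonempty_iso_subscheme_comap_ker_symm {D S U : Scheme.{0}} (i : D ⟶ U) (s : S ⟶ U)
    [IsClosedImmersion i] [IsClosedImmersion s] :
    Nonempty ((s.ker.comap i).subscheme ≅ (i.ker.comap s).subscheme) := by
  refine ⟨(s.ker.comapIso i) ≪≫ ?_ ≪≫ (i.ker.comapIso s).symm⟩
  refine (Limits.pullback.congrHom rfl s.toImage_imageι.symm ≪≫ ?_).symm ≪≫ Limits.pullbackSymmetry i s ≪≫
    (Limits.pullback.congrHom rfl i.toImage_imageι.symm ≪≫ ?_)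
  · exact asIso (Limits.pullback.map i (s.toImage ≫ s.ker.subschemeι) i s.ker.subschemeι (𝟙 _) s.toImage
      (𝟙 _) (by simp) (by simp))
  · exact asIso (Limits.pullback.map s (i.toImage ≫ i.ker.subschemeι) s i.ker.subschemeι (𝟙 _) i.toImage
      (𝟙 _) (by simp) (by simp))

/-- **COMB C1's hypothesis on the section side.** Regularity of the scheme-theoretic intersection `D ∩ S` may be
checked on either factor: if `V(𝓘_D·𝒪_S) ⊆ S` is regular then so is `V(𝓘_S·𝒪_D) ⊆ D` — the hypothesis `hDC` of
`isRegular_reducedStrictTransform_of_isRegular_comap` for the centre `C = s.ker` of a SECTION `s : Spec O ⟶ P`, read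
on `Spec O`: at `ϖ`-distance exactly one `V(𝓘_D·𝒪_{Spec O}) = Spec O/(u·ϖ) = Spec k` is the reduced closed point, regular
by the tree theorem `isRegular_subscheme_vanishingIdeal_singleton` (Literature `PointCentrePermissible`). [folklore] -/
theorem isRegular_subscheme_comap_ker_symm {D S U : Scheme.{0}} (i : D ⟶ U) (s : S ⟶ U)
    [IsClosedImmersion i] [IsClosedImmersion s] (h : Scheme.IsRegular (i.ker.comap s).subscheme) :
    Scheme.IsRegular (s.ker.comap i).subscheme := by
  obtain ⟨e⟩ := nonempty_iso_subscheme_comap_ker_symm i s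
  exact Scheme.IsRegular.of_isOpenImmersion e.hom h

end Summit.ResolutionOfSingularities.ResolutionOfSingularities.Theorems.EquisingularLiftNat.CombCentre

end
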